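import Mathlib

/-!
# Predictable (triangular) shifts of a finite sequence preserve Lebesgue measure; the discrete Cameron–Martin / Girsanov reweighting

Helper file for stub `stub_antiDampedGirsanov` (K3) of line `lebesgue-flip-duality`, crux ★
`BondHeatUncertainty.LinearResponseFTUR` (stmt-AtomisticToContinuum-9122). The anti-damped Girsanov
formula is proved WITHOUT a stochastic-integration Girsanov theorem: on a time grid the damped and the
anti-damped splitting schemes of the chain are the same deterministic function of the vector of Brownian
increments `x = (x_k)_{k<n}` up to a PREDICTABLE affine change of variables
`(S x)_k = T(x_k) + a_k(x_0, …, x_{k-1})` (`T` = `± id`, `a_k` = the friction impulse of step `k`, a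
function of the PAST increments only). This file is the finite-dimensional measure theory of such maps:

* `measurePreserving_predictableShift` — for a finite-dimensional real space `V` with its additive
  Haar (Lebesgue) measure, a measure-preserving measurable `T : V → V` and a measurable PREDICTABLE
  `a : (Fin n → V) → (Fin n → V)` (`a x k` depends only on `x j`, `j < k`), the map
  `x ↦ (k ↦ T (x k) + a x k)` preserves Lebesgue measure on `Fin n → V` (induction on `n`: under
  `piFinSuccAbove (last n)` it is a skew product of the shift of the first `n` coordinates with the
  measure-preserving fibre maps `v ↦ T v + a x (last n)`, Mathlib `MeasurePreserving.skew_product`);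
* `lintegral_withDensity_eq_lintegral_comp_mul` — **the reweighting identity**: for a measure-preserving
  `S` and an everywhere positive finite density `φ`,
  `∫ Ψ d(φ·vol) = ∫ Ψ(S x) · (φ(S x)/φ(x)) d(φ·vol)(x)` — with `φ` a product of centred Gaussian densities
  and `S` the scheme-to-scheme map this is the exact discrete Girsanov formula (Cameron–Martin for the
  Gaussian vector of increments), the density ratio being `exp(Σ_k (2⟨T x_k, a_k⟩ + ‖a_k‖²)·(-1/2h))`.

Pure Mathlib; nothing here is specific to the chain.
-/

noncomputable section

namespace Summit.AtomisticToContinuum.FouriersLaw.Theorems.LinearResponseFTUR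

open MeasureTheory Filter Set Function
open scoped ENNReal

section Predictable

variable {V : Type*} [Zero V]

/-- Restriction of a predictable shift of `n + 1` variables to the first `n` variables: feed any value
(here `0`) in the last slot. -/
theorem predictable_castSucc {n : ℕ} (a : (Fin (n + 1) → V) → (Fin (n + 1) → V))
    (hpred : ∀ (x y : Fin (n + 1) → V) (k : Fin (n + 1)), (∀ j : Fin (n + 1), j < k → x j = y j) →
      a x k = a y k)
    (x : Fin (n + 1) → V) (k : Fin n) :
    a x (Fin.castSucc k) = a (Fin.snoc (fun j => x (Fin.castSucc j)) 0) (Fin.castSucc k) := by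
  refine hpred x _ (Fin.castSucc k) fun j hj => ?_
  have hjl : j ≠ Fin.last n := by
    intro h
    rw [h] at hj
    exact (Fin.not_lt.mpr (Fin.le_last _)) hj
  obtain ⟨j', rfl⟩ := Fin.exists_castSucc_eq.mpr hjl
  simp [Fin.snoc_castSucc]

/-- The last component of a predictable shift does not depend on the last variable. -/
theorem predictable_last {n : ℕ} (a : (Fin (n + 1) → V) → (Fin (n + 1) → V))
    (hpred : ∀ (x y : Fin (n + 1) → V) (k : Fin (n + 1)), (∀ j : Fin (n + 1), j < k → x j = y j) →
      a x k = a y k)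
    (x : Fin (n + 1) → V) :
    a x (Fin.last n) = a (Fin.snoc (fun j => x (Fin.castSucc j)) 0) (Fin.last n) := by
  refine hpred x _ (Fin.last n) fun j hj => ?_
  have hjl : j ≠ Fin.last n := ne_of_lt hj
  obtain ⟨j', rfl⟩ := Fin.exists_castSucc_eq.mpr hjl
  simp [Fin.snoc_castSucc]

end Predictable

section Shift

variable {V : Type*} [NormedAddCommGroup V] [NormedSpace ℝ V] [FiniteDimensional ℝ V]
  [MeasureSpace V] [BorelSpace V] [(volume : Measure V).IsAddHaarMeasure]

/-- **A predictable affine shift preserves Lebesgue measure.** For a measure-preserving measurable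
`T : V → V` (e.g. `id` or `-id`) and a measurable predictable `a` (component `k` depends only on the
variables `j < k`), `x ↦ (k ↦ T (x k) + a x k)` preserves the product Lebesgue measure on `Fin n → V`. -/
theorem measurePreserving_predictableShift :
    ∀ (T : V → V), MeasurePreserving T volume volume →
    ∀ (n : ℕ) (a : (Fin n → V) → (Fin n → V)), Measurable a →
      (∀ (x y : Fin n → V) (k : Fin n), (∀ j : Fin n, j < k → x j = y j) → a x k = a y k) →
      MeasurePreserving (fun x : Fin n → V => fun k => T (x k) + a x k) volume volume := by
  intro T hT n
  induction n with
  | zero =>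
    intro a _ _
    have : (fun x : Fin 0 → V => fun k => T (x k) + a x k) = id := by
      funext x k; exact k.elim0
    rw [this]
    exact MeasurePreserving.id _
  | succ n ih =>
    intro a ha hpred
    -- the shift of the first `n` variables
    set a' : (Fin n → V) → (Fin n → V) := fun x' k => a (Fin.snoc x' 0) (Fin.castSucc k) with ha'
    have hsnoc : Measurable fun x' : Fin n → V => (Fin.snoc x' (0 : V) : Fin (n + 1) → V) := by
      refine measurable_pi_lambda _ fun j => ?_
      refine Fin.lastCases ?_ (fun j' => ?_) j
      · simp only [Fin.snoc_last]; exact measurable_const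
      · simp only [Fin.snoc_castSucc]; exact measurable_pi_apply j'
    have ha'm : Measurable a' := by
      refine measurable_pi_lambda _ fun k => ?_
      exact (measurable_pi_apply (Fin.castSucc k)).comp (ha.comp hsnoc)
    have hpred' : ∀ (x y : Fin n → V) (k : Fin n), (∀ j : Fin n, j < k → x j = y j) →
        a' x k = a' y k := by
      intro x y k hxy
      refine hpred _ _ (Fin.castSucc k) fun j hj => ?_
      have hjl : j ≠ Fin.last n := by
        intro h; rw [h] at hj; exact (Fin.not_lt.mpr (Fin.le_last _)) hj
      obtain ⟨j', rfl⟩ := Fin.exists_castSucc_eq.mpr hjl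
      simp only [Fin.snoc_castSucc]
      exact hxy j' (Fin.castSucc_lt_castSucc_iff.mp hj)
    have hS' := ih a' ha'm hpred'
    -- the last-slot impulse as a function of the first `n` variables
    set c : (Fin n → V) → V := fun x' => a (Fin.snoc x' 0) (Fin.last n) with hc
    have hcm : Measurable c := (measurable_pi_apply (Fin.last n)).comp (ha.comp hsnoc)
    -- the skew product `(x', v) ↦ (S' x', T v + c x')` preserves `vol ⊗ vol`
    have hskew : MeasurePreserving
        (fun p : (Fin n → V) × V => ((fun k => T (p.1 k) + a' p.1 k), T p.2 + c p.1))
        ((volume : Measure (Fin n → V)).prod volume) ((volume : Measure (Fin n → V)).prod volume) := by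
      refine hS'.skew_product (g := fun x' v => T v + c x') ?_ ?_
      · exact (hT.measurable.comp measurable_snd).add (hcm.comp measurable_fst)
      · refine Filter.Eventually.of_forall fun x' => ?_
        have h1 : (fun v => T v + c x') = (fun v => v + c x') ∘ T := rfl
        rw [h1, ← Measure.map_map (measurable_add_const _) hT.measurable, hT.map_eq]
        exact map_add_right_eq_self _ _
    -- conjugate by the measurable equivalence `(Fin (n+1) → V) ≃ V × (Fin n → V)` at the last slot
    set e := MeasurableEquiv.piFinSuccAbove (fun _ : Fin (n + 1) => V) (Fin.last n) with he
    have hem : MeasurePreserving e volume ((volume : Measure V).prod volume) :=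
      measurePreserving_piFinSuccAbove (fun _ : Fin (n + 1) => (volume : Measure V)) (Fin.last n)
    have hex : ∀ y : Fin (n + 1) → V, e y = (y (Fin.last n), fun j => y (Fin.castSucc j)) := by
      intro y
      rw [he, MeasurableEquiv.piFinSuccAbove_apply, Fin.insertNthEquiv_symm_apply, Fin.removeNth_last]
      rfl
    have hswap : MeasurePreserving (Prod.swap : V × (Fin n → V) → (Fin n → V) × V)
        ((volume : Measure V).prod volume) ((volume : Measure (Fin n → V)).prod volume) :=
      Measure.measurePreserving_swap
    -- the identity `S = e⁻¹ ∘ swap⁻¹ ∘ skew ∘ swap ∘ e`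
    have hfun : (fun x : Fin (n + 1) → V => fun k => T (x k) + a x k) =
        e.symm ∘ Prod.swap ∘
          (fun p : (Fin n → V) × V => ((fun k => T (p.1 k) + a' p.1 k), T p.2 + c p.1)) ∘
          Prod.swap ∘ e := by
      funext x
      apply e.injective
      rw [Function.comp_apply, Function.comp_apply, Function.comp_apply, Function.comp_apply,
        e.apply_symm_apply]
      -- both sides as pairs (last slot, first slots)
      rw [hex, hex]
      simp only [Prod.swap_prod_mk]
      refine Prod.ext ?_ ?_
      · change T (x (Fin.last n)) + a x (Fin.last n) =
          T (x (Fin.last n)) + a (Fin.snoc (fun j => x (Fin.castSucc j)) 0) (Fin.last n)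
        rw [← predictable_last a hpred x]
      · funext k
        change T (x (Fin.castSucc k)) + a x (Fin.castSucc k) =
          T (x (Fin.castSucc k)) + a (Fin.snoc (fun j => x (Fin.castSucc j)) 0) (Fin.castSucc k)
        rw [← predictable_castSucc a hpred x k]
    rw [hfun]
    have hsymm : MeasurePreserving e.symm ((volume : Measure V).prod volume) volume := hem.symm
    have hswap' : MeasurePreserving (Prod.swap : (Fin n → V) × V → V × (Fin n → V))
        ((volume : Measure (Fin n → V)).prod volume) ((volume : Measure V).prod volume) :=
      Measure.measurePreserving_swap
    exact hsymm.comp (hswap'.comp (hskew.comp (hswap.comp hem)))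

end Shift

section Reweight

variable {X : Type*} [MeasurableSpace X]

/-- **The reweighting identity (discrete Cameron–Martin / Girsanov).** If `S` preserves the reference
measure `ν` and `φ` is an everywhere positive, finite, measurable density, then for every measurable
`Ψ ≥ 0`: `∫ Ψ d(φ·ν) = ∫ Ψ(S x) (φ(S x) / φ x) d(φ·ν)(x)`. -/
theorem lintegral_withDensity_eq_lintegral_comp_mul {ν : Measure X} {S : X → X}
    (hS : MeasurePreserving S ν ν) {φ : X → ℝ≥0∞} (hφ : Measurable φ) (hφ0 : ∀ x, φ x ≠ 0)
    (hφtop : ∀ x, φ x ≠ ∞) {Ψ : X → ℝ≥0∞} (hΨ : Measurable Ψ) :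
    ∫⁻ x, Ψ x ∂(ν.withDensity φ) = ∫⁻ x, Ψ (S x) * (φ (S x) / φ x) ∂(ν.withDensity φ) := by
  have hm : Measurable fun x => Ψ (S x) * (φ (S x) / φ x) :=
    (hΨ.comp hS.measurable).mul ((hφ.comp hS.measurable).div hφ)
  rw [lintegral_withDensity_eq_lintegral_mul _ hφ hΨ, lintegral_withDensity_eq_lintegral_mul _ hφ hm]
  have h1 : ∫⁻ x, (φ * Ψ) x ∂ν = ∫⁻ x, (φ * Ψ) (S x) ∂ν :=
    (hS.lintegral_comp (hφ.mul hΨ)).symm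
  rw [h1]
  refine lintegral_congr fun x => ?_
  simp only [Pi.mul_apply]
  rw [mul_comm (φ x), mul_assoc, ENNReal.div_mul_cancel (hφ0 x) (hφtop x), mul_comm]

/-- The reweighting identity for the image of a measure: if the law of `ξ` under `P` is `φ·ν` with `φ`
positive finite and `S` preserves `ν`, then `E[Ψ(ξ)] = E[Ψ(S ξ) · φ(S ξ)/φ(ξ)]`. -/
theorem lintegral_comp_eq_lintegral_comp_shift_mul {Ω : Type*} [MeasurableSpace Ω] {P : Measure Ω}
    {ξ : Ω → X} (hξ : Measurable ξ) {ν : Measure X} {S : X → X} (hS : MeasurePreserving S ν ν)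
    {φ : X → ℝ≥0∞} (hφ : Measurable φ) (hφ0 : ∀ x, φ x ≠ 0) (hφtop : ∀ x, φ x ≠ ∞)
    (hlaw : P.map ξ = ν.withDensity φ) {Ψ : X → ℝ≥0∞} (hΨ : Measurable Ψ) :
    ∫⁻ ω, Ψ (ξ ω) ∂P = ∫⁻ ω, Ψ (S (ξ ω)) * (φ (S (ξ ω)) / φ (ξ ω)) ∂P := by
  have hm : Measurable fun x => Ψ (S x) * (φ (S x) / φ x) :=
    (hΨ.comp hS.measurable).mul ((hφ.comp hS.measurable).div hφ)
  rw [← lintegral_map hΨ hξ, ← lintegral_map hm hξ, hlaw]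
  exact lintegral_withDensity_eq_lintegral_comp_mul hS hφ hφ0 hφtop hΨ

end Reweight

end Summit.AtomisticToContinuum.FouriersLaw.Theorems.LinearResponseFTUR

end
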